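import Literature.AlgebraicGeometry.Resolution.TransverseDerivationBlowup
import Literature.AlgebraicGeometry.Resolution.HypersurfaceRestrictionTransform
import Literature.AlgebraicGeometry.Resolution.DerivativeIdealsBlowup
import Literature.AlgebraicGeometry.Resolution.MarkedIdealsArithmetic
import HarnessLib

/-!
# Persistence of `supp(𝓘, μ) ∩ S = supp(𝒞(𝓘, μ)|_S)` under blow-ups (BGMW 2011, Lemma 3.9.4 (2); [Wlod] Lemma 3.10.4)

Topic: `Literature/AlgebraicGeometry/Resolution`. Layer of the decomposition of the named facts
`BierstoneGrigorievMilmanWlodarczyk2011_marked` (`EffectiveResolutionMarked.lean`) and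
`BierstoneGrigorievMilmanWlodarczyk2011_canonical` (`CanonicalResolution.lean`; Bierstone–
Grigoriev–Milman–Włodarczyk, arXiv:1206.3090, Thm. 8.0.5). The induction on dimension in Step 1
of the algorithm (§4) rests on Lemma 3.9.4: for a marked ideal `(X, 𝓘, E, μ)` of maximal order
and a smooth hypersurface `S` (snc with `E`),

  "`supp(𝓘, μ) ∩ S = supp(𝒞(𝓘, μ)|_S)`. Moreover let `(X_i)` be a multiple blow-up with centers
  `C_i` contained in the strict transforms `S_i ⊂ X_i` of `S`. Then: (1) The restrictions
  `σ_{i|S_i} : S_i → S_{i-1}` of the morphisms `σ_i : X_i → X_{i-1}` define a multiple blow-up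
  `(S_i)` of `𝒞(𝓘, μ)|_S`. (2) `supp(𝓘_i, μ) ∩ S_i = supp[𝒞(𝓘, μ)|_S]_i`. (3) Every multiple
  blow-up `(S_i)` of `𝒞(𝓘, μ)|_S` defines a multiple blow-up `(X_i)` of `(𝓘, μ)` …",

whose proof is "The above relation is preserved by multiple blow-ups of `(𝓘, μ)`. For details
see [Wlod]" — Włodarczyk, *Simple Hironaka resolution in characteristic zero*, Lemma 3.10.4,
where the persistence is proved by carrying along the blow-ups an expansion
`f_k = Σ c_{α f k}(y) x^α` of the controlled transforms of the elements of `𝓘` in formal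
coordinates, with `c_{α f k}|_{S_k}` in the transforms of `𝒟^{|α|}(𝓘)|_S`. The first claim is
`CoefficientIdealRestriction.lean` (hypersurface case, via one transverse derivation instead of
formal coordinates). This file PROVES clause (2) for ONE blow-up, for a regular hypersurface
`S = V(H)` given around its points by sections of order one, in a form whose hypotheses
re-establish themselves on the blow-up — so that it iterates along multiple blow-ups with centres
in the successive strict transforms of `S` (the iteration over a concrete sequence type is left
to the assembly of Step 1). The invariant carried along (derivation form of [Wlod]'s expansion,
`TransverseDerivationBlowup.lean`) is, for ideal sheaves `K_0, K_1, …` (initially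
`K_i = 𝒟ⁱ(𝓘)`, then their controlled transforms with multiplicities `μ - i`):

  (T) every point of `V(H)` has an affine neighbourhood `U` with `H|_U = (u)` and a derivation
      `δ` of `Γ(X, U)` with `δ(u)` a unit modulo `u` and `δ^j f ∈ (K_0 + ⋯ + K_j)(U)` for all
      `f ∈ 𝓘(U)`, `j < μ`

(derivations over `ℤ`; no `k`-structure is needed for (T) itself), together with
`K_i ⊆ 𝒟ⁱ(𝓘)` and the shape `𝒩 = (Σ_{i<μ} (K_i|_S)^{Π_{j≠i}(μ-j)}, Π_j(μ-j))` of the marked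
ideal on `S` (initially `𝒩 = 𝒞(𝓘, μ)|_S`, Def. 3.9.2; then its transforms). PROVED:

* `transverse_derivIdealSheafIter` — **(T) holds at the start** with `K_i = 𝒟ⁱ(𝓘)` on a scheme
  with finitely presented differentials and local coordinates with dual derivations
  (`exists_derivation_isUnit_germ`: an order-one section has a derivation not vanishing at the
  point, by `germ_mem_sq_iff_mem_zeroLocus_derivIdeal`; shrink to the basic open where `δ(u)` is
  invertible and extend `δ` to the localization);
* **`IsBlowup.transverse_transform`** — **(T) persists** under a blow-up along `C ⊇ H` (i.e.
  `V(C) ⊆ S`) with `𝓘 ⊆ C^μ`, `K_i ⊆ C^{μ-i}` (Lemma 3.2.1), for `H' = σᶜ(H, 1)`,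
  `𝓘' = σᶜ(𝓘, μ)`, `K_i' = σᶜ(K_i, μ - i)` (chart `Γ(X', V) ≅ Γ(X, U)[C(U)/b]`, the derivation
  `b·δ`, `forall_iterate_transform_mem_iSup_colon`);
* `stalkIdeal_le_pow_of_transverse` — **using (T) at a point**: if `K_{i,x} ⊆ 𝔪_x^{μ-i} + (u_x)`
  for all `i < μ` and `1, …, μ - 1` are units, then `𝓘_x ⊆ 𝔪_x^μ` (extend `δ` to the stalk,
  rescale to `δ(u_x) = 1`, `Derivation.mem_pow_of_forall_iterate_mem_sup`);
* **`MarkedIdeal.support_eq_preimage_of_transverse`** — **clause (2) at any stage**: under (T),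
  `K_i ⊆ 𝒟ⁱ(𝓘)`, regular ambient local rings and order-one stalk generators along `V(H)`:
  `supp 𝒩 = ι⁻¹ supp(𝓘, μ)` for the marked ideal `𝒩` of the above shape on `S`;
* `IsBlowup.transform_ideal_of_eq_iSup_comap_subschemeι` — **the shape of `𝒩` persists**: the
  transform of `𝒩` along the induced blow-up `πS : S' → S` (centre `C|_S`) has ideal
  `Σ_i (K_i'|_{S'})^{Π_{j≠i}(μ-j)}` (`controlledTransform_finset_biSup_pow`, Lemma 3.7.1, and
  `(σᶜ K_i)|_{S'} = (πS)ᶜ(K_i|_S)`, [Wlod] Lemma 3.10.3, `HypersurfaceRestrictionTransform.lean`);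
  `MarkedIdeal.coeff_comap_ideal` — the shape at the start;
* **`IsBlowup.support_transform_coeff_comap_subschemeι`** — **Lemma 3.9.4 (2) for one blow-up**:
  `supp((𝒞(𝓘, μ)|_S)') = ι'⁻¹ supp((𝓘, μ)')` on the strict transform `S' = V(H')`, for an
  admissible centre `C` with `H ⊆ C` on a regular scheme with `k`-structure as above and
  `1, …, μ - 1` units (characteristic zero or `p ≥ μ`, Thm. 8.0.4); `K_i' ⊆ 𝒟ⁱ(𝓘')` being
  Lemma 3.5.3 (`DerivativeIdealsBlowup.lean`) and the order-one generators of `H'` Lemma 3.6.4 (4)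
  (`HypersurfaceTransform.lean`).

Also: `Scheme.IdealSheafData.comap_iSup`, `controlledTransform_bot`,
`controlledTransform_finset_biSup_pow` (`σᶜ(Σ L_i^{e_i}, N) = Σ σᶜ(L_i, m_i)^{e_i}` when
`e_i m_i = N`), `IsBlowup.exists_chart_of_mem`, and small lemmas on iterated derivations
(`Derivation.forall_iterate_mem_of_mem_span`, `Derivation.iterate_smul_mem`,
`Derivation.iterate_apply_algebraMap`).

## Sources

* E. Bierstone, D. Grigoriev, P. Milman, J. Włodarczyk, *Effective Hironaka resolution and its
  complexity*, arXiv:1206.3090 (arXiv numbering): Lemma 3.2.1 (p. 6), Lemma 3.5.3 (p. 7),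
  Lemma 3.6.4 (p. 8), Lemma 3.7.1 (p. 8), Def. 3.9.2 and Lemma 3.9.4 (p. 10), §4 Step 1 and
  Remark (3) (p. 11), Thm. 8.0.4 (p. 23). [BierstoneGrigorievMilmanWlodarczyk2011]
* J. Włodarczyk, *Simple Hironaka resolution in characteristic zero*, J. AMS 18 (2005),
  Lemmas 3.10.3–3.10.4 and their proofs (arXiv:math/0401401 numbering, pp. 13–14). [Wlodarczyk2005]
* The Stacks Project, Tag 0804 (charts of a blow-up). [StacksProject]
-/

noncomputable section

open CategoryTheory CategoryTheory.Limits AlgebraicGeometry TopologicalSpace IsLocalRing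
open scoped nonZeroDivisors

namespace Literature.AlgebraicGeometry.Resolution

universe u v

/-! ## Generalities on ideal sheaves -/

section General

variable {X X' : Scheme.{u}}

/-- Inverse image commutes with arbitrary suprema of ideal sheaves (it is a left adjoint).
[folklore] -/
theorem Scheme.IdealSheafData.comap_iSup {ι : Sort*} (I : ι → X.IdealSheafData) (f : X' ⟶ X) :
    (⨆ i, I i).comap f = ⨆ i, (I i).comap f :=
  (Scheme.IdealSheafData.map_gc f).l_iSup

variable {σ : X' ⟶ X} {C : X.IdealSheafData}

/-- The controlled transform of the zero ideal is zero (the exceptional divisor being an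
effective Cartier divisor). [folklore] -/
theorem controlledTransform_bot (hD : IsEffectiveCartier (C.comap σ)) (m : ℕ) :
    controlledTransform σ C ⊥ m = ⊥ := by
  unfold controlledTransform
  rw [comap_bot]
  exact (hD.pow m).eq_bot_of_mul_eq_bot (le_bot_iff.mp (mul_colon_le ⊥ _))

/-- **Controlled transform of a finite sum of powers** (BGMW Lemma 3.7.1 (1)–(2), "moreover",
iterated; the shape of the coefficient ideal `𝒞(𝓘, μ) = Σ_i (𝒟ⁱ𝓘)^{e_i}`): if `e_i m_i = N` and
`σ^*L_i ⊆ 𝓘(D)^{m_i}` for all `i ∈ s`, then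
`σᶜ(Σ_{i∈s} L_i^{e_i}, N) = Σ_{i∈s} σᶜ(L_i, m_i)^{e_i}`.
[cite: BierstoneGrigorievMilmanWlodarczyk2011, Lemma 3.7.1] -/
theorem controlledTransform_finset_biSup_pow [IsLocallyNoetherian X']
    (hD : IsEffectiveCartier (C.comap σ)) {ι : Type*}
    (s : Finset ι) (L : ι → X.IdealSheafData) (m e : ι → ℕ) {N : ℕ}
    (hN : ∀ i ∈ s, e i * m i = N) (hL : ∀ i ∈ s, (L i).comap σ ≤ C.comap σ ^ m i) :
    controlledTransform σ C (⨆ i ∈ s, L i ^ e i) N =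
      ⨆ i ∈ s, controlledTransform σ C (L i) (m i) ^ e i := by
  classical
  induction s using Finset.induction_on with
  | empty => simp [controlledTransform_bot hD]
  | insert a s ha ih =>
    have hN' : ∀ i ∈ s, e i * m i = N := fun i hi => hN i (Finset.mem_insert_of_mem hi)
    have hL' : ∀ i ∈ s, (L i).comap σ ≤ C.comap σ ^ m i :=
      fun i hi => hL i (Finset.mem_insert_of_mem hi)
    have hpow : ∀ i ∈ insert a s, (L i ^ e i).comap σ ≤ C.comap σ ^ N := by
      intro i hi
      rw [comap_pow, ← hN i hi, mul_comm, pow_mul]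
      exact pow_le_pow_left' (hL i hi) (e i)
    have hsup : (⨆ i ∈ s, L i ^ e i).comap σ ≤ C.comap σ ^ N := by
      rw [Scheme.IdealSheafData.comap_iSup]
      refine iSup_le fun i => ?_
      rw [Scheme.IdealSheafData.comap_iSup]
      exact iSup_le fun hi => hpow i (Finset.mem_insert_of_mem hi)
    rw [Finset.iSup_insert, Finset.iSup_insert,
      controlledTransform_sup hD (hpow a (Finset.mem_insert_self a s)) hsup, ih hN' hL',
      ← hN a (Finset.mem_insert_self a s), controlledTransform_pow hD (hL a (Finset.mem_insert_self a s))]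

end General

/-! ## Charts of a blow-up over a given affine open -/

section Charts

variable {X X' : Scheme.{u}} {π : X' ⟶ X} {C : X.IdealSheafData}

/-- **Charts of a blow-up on sections, over a given affine open** (`IsBlowup.exists_chart` with
`U ∋ π x'` prescribed): `x' ∈ V ⊆ π⁻¹U` affine with `Γ(X', V) ≅ Γ(X, U)[C(U)/b]` over `Γ(X, U)`.
[cite: StacksProject, Tag 0804] -/
theorem IsBlowup.exists_chart_of_mem (hπ : IsBlowup π C) (U : X.affineOpens) {x' : X'}
    (hxU : π x' ∈ (U : X.Opens)) :
    ∃ (V : X'.affineOpens) (hVU : (V : X'.Opens) ≤ π ⁻¹ᵁ (U : X.Opens))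
      (b : Γ(X, U)) (_ : b ∈ C.ideal U) (e : Γ(X', V) ≃+* blowupAlgebra (C.ideal U) b),
      x' ∈ (V : X'.Opens) ∧
        e.toRingHom.comp (π.appLE U V hVU).hom =
          algebraMap Γ(X, U) (blowupAlgebra (C.ideal U) b) := by
  obtain ⟨b, hb, g, hg, hx', hgπ⟩ := hπ.exists_blowupAlgebra_chart_of_mem U hxU
  haveI := hg
  have hVU := image_top_le_preimage_of_comp_eq π g U _ hgπ
  have key := appLE_appIso_ΓSpecIso_of_comp_eq π g U _ hgπ hVU
  refine ⟨⟨g ''ᵁ ⊤, (isAffineOpen_top _).image_of_isOpenImmersion g⟩, hVU, b, hb,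
    ((g.appIso ⊤) ≪≫ Scheme.ΓSpecIso _).commRingCatIsoToRingEquiv, ?_, ?_⟩
  · obtain ⟨z, rfl⟩ := hx'
    exact ⟨z, trivial, rfl⟩
  · have key' := congrArg CommRingCat.Hom.hom key
    rw [CommRingCat.hom_comp, CommRingCat.hom_ofHom] at key'
    exact key'

end Charts

/-! ## Derivations: ideal conditions on iterates -/

section Derivations

variable {R : Type*} {A : Type*} [CommRing R] [CommRing A] [Algebra R A]

/-- If the generators of an ideal satisfy "`D^j g ∈ F_j` for all `j < μ`" for a monotone family
`F`, so does every element of the ideal. [folklore] -/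
theorem Derivation.forall_iterate_mem_of_mem_span (D : Derivation R A A) {F : ℕ → Ideal A}
    (hF : Monotone F) {μ : ℕ} {G : Set A} (hG : ∀ g ∈ G, ∀ j < μ, D^[j] g ∈ F j) :
    ∀ h ∈ Ideal.span G, ∀ j < μ, D^[j] h ∈ F j := by
  intro h hh
  refine Submodule.span_induction (p := fun x _ => ∀ j < μ, D^[j] x ∈ F j) hG ?_ ?_ ?_ hh
  · have hD0 : ∀ n : ℕ, D^[n] (0 : A) = 0 := fun n => by
      induction n with
      | zero => rfl
      | succ n ih => rw [Function.iterate_succ_apply', ih, map_zero]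
    intro j _
    rw [hD0]
    exact zero_mem _
  · intro x y _ _ hx hy j hj
    rw [Derivation.iterate_map_add R D]
    exact add_mem (hx j hj) (hy j hj)
  · intro s x _ hx j hj
    rcases Nat.eq_zero_or_pos μ with hμ | hμ
    · omega
    · exact Derivation.forall_iterate_mul_mem D (μ - 1) F hF s x
        (fun l hl => hx l (by omega)) j (by omega)

/-- Iterates of a rescaled derivation are combinations of the iterates:
`(c·D)^j f ∈ A·f + A·Df + ⋯ + A·D^j f`. [folklore] -/
theorem Derivation.iterate_smul_mem_span (D : Derivation R A A) (c f : A) (j : ℕ) :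
    (c • D)^[j] f ∈ Ideal.span ((fun i => D^[i] f) '' Set.Iic j) := by
  induction j with
  | zero => exact Ideal.subset_span ⟨0, Set.mem_Iic.mpr le_rfl, rfl⟩
  | succ j ih =>
    rw [Function.iterate_succ_apply']
    have hsub : Ideal.span ((fun i => D^[i] f) '' Set.Iic j) ≤
        Ideal.span ((fun i => D^[i] f) '' Set.Iic (j + 1)) :=
      Ideal.span_mono (Set.image_mono (Set.Iic_subset_Iic.mpr (Nat.le_succ j)))
    refine Submodule.span_induction
      (p := fun x _ => (c • D) x ∈ Ideal.span ((fun i => D^[i] f) '' Set.Iic (j + 1)))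
      ?_ ?_ ?_ ?_ ih
    · rintro _ ⟨i, hi, rfl⟩
      rw [Set.mem_Iic] at hi
      rw [Derivation.smul_apply, smul_eq_mul, ← Function.iterate_succ_apply' D i f]
      exact Ideal.mul_mem_left _ _ (Ideal.subset_span ⟨i + 1, Set.mem_Iic.mpr (by omega), rfl⟩)
    · rw [map_zero]
      exact zero_mem _
    · intro x y _ _ hx hy
      rw [map_add]
      exact add_mem hx hy
    · intro s x hx hDx
      rw [smul_eq_mul, Derivation.leibniz, smul_eq_mul, smul_eq_mul]
      exact add_mem (Ideal.mul_mem_left _ _ hDx) (Ideal.mul_mem_right _ _ (hsub hx))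

/-- Hence "`D^i f ∈ F_i` for all `i ≤ j`" (monotone `F`) implies `(c·D)^j f ∈ F_j`. [folklore] -/
theorem Derivation.iterate_smul_mem (D : Derivation R A A) {F : ℕ → Ideal A} (hF : Monotone F)
    (c f : A) {j : ℕ} (h : ∀ i ≤ j, D^[i] f ∈ F i) : (c • D)^[j] f ∈ F j := by
  refine (Ideal.span_le.mpr ?_) (Derivation.iterate_smul_mem_span D c f j)
  rintro _ ⟨i, hi, rfl⟩
  rw [Set.mem_Iic] at hi
  exact hF hi (h i hi)

/-- Iterates of an extended derivation: if `δ'` extends `δ` along `A → B`, then `δ'^j` extends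
`δ^j`. [folklore] -/
theorem Derivation.iterate_apply_algebraMap {B : Type*} [CommRing B] [Algebra R B] [Algebra A B]
    (δ : Derivation R A A) (δ' : Derivation R B B)
    (h : ∀ a : A, δ' (algebraMap A B a) = algebraMap A B (δ a)) (j : ℕ) (a : A) :
    δ'^[j] (algebraMap A B a) = algebraMap A B (δ^[j] a) := by
  induction j with
  | zero => rfl
  | succ j ih => rw [Function.iterate_succ_apply', ih, h, Function.iterate_succ_apply']

end Derivations

/-! ## The transverse invariant persists under a blow-up with centre in `S` -/

section OneStep

variable {X X' : Scheme.{u}} {π : X' ⟶ X} {C H : X.IdealSheafData}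

/-- **[Wlod] Lemma 3.10.4, induction step (derivation form): the transverse invariant persists
under a blow-up whose centre lies in the hypersurface.** Let `π : X' → X` be a blow-up along `C`
with `H ⊆ C` (so `V(C) ⊆ S = V(H)`), `𝓘 ⊆ C^μ` and `K_i ⊆ C^{μ-i}` (`i < μ`; BGMW Lemma 3.2.1 for
admissible centres). Suppose every point of `V(H)` has an affine neighbourhood `U` with
`H|_U = (u)` and a derivation `δ` of `Γ(X, U)` with `δ(u)` a unit modulo `u` and
`δ^j f ∈ (K_0 + ⋯ + K_j)(U)` for all `f ∈ 𝓘(U)`, `j < μ`. Then the same holds on `X'` for the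
transforms `H' = σᶜ(H, 1)`, `𝓘' = σᶜ(𝓘, μ)`, `K_i' = σᶜ(K_i, μ - i)`: on the chart `V ∋ x'` over
`U` (`Γ(X', V) ≅ Γ(X, U)[C(U)/b]`), `H'|_V = (u/b)` and the extension `D` of `b·δ` is the required
derivation (`TransverseDerivationBlowup.lean`). [cite: Wlodarczyk2005, Lemma 3.10.4 (proof)] -/
theorem IsBlowup.transverse_transform [IsLocallyNoetherian X'] (hπ : IsBlowup π C) (hHC : H ≤ C)
    {I : X.IdealSheafData} {μ : ℕ} {K : ℕ → X.IdealSheafData} (hI : I ≤ C ^ μ)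
    (hK : ∀ i < μ, K i ≤ C ^ (μ - i))
    (hT : ∀ x ∈ H.support, ∃ U : X.affineOpens, x ∈ (U : X.Opens) ∧ ∃ u : Γ(X, U),
      H.ideal U = Ideal.span {u} ∧ ∃ δ : Derivation ℤ Γ(X, U) Γ(X, U),
        IsUnit (Ideal.Quotient.mk (Ideal.span {u}) (δ u)) ∧
        ∀ f ∈ I.ideal U, ∀ j < μ, δ^[j] f ∈ ⨆ (i : ℕ) (_ : i ≤ j), (K i).ideal U) :
    ∀ x' ∈ (controlledTransform π C H 1).support, ∃ V : X'.affineOpens, x' ∈ (V : X'.Opens) ∧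
      ∃ u' : Γ(X', V), (controlledTransform π C H 1).ideal V = Ideal.span {u'} ∧
        ∃ δ' : Derivation ℤ Γ(X', V) Γ(X', V),
          IsUnit (Ideal.Quotient.mk (Ideal.span {u'}) (δ' u')) ∧
          ∀ f' ∈ (controlledTransform π C I μ).ideal V, ∀ j < μ,
            δ'^[j] f' ∈ ⨆ (i : ℕ) (_ : i ≤ j), (controlledTransform π C (K i) (μ - i)).ideal V := by
  intro x' hx'
  -- `π x' ∈ V(H)`
  have hx : π x' ∈ H.support := by
    have h1 : x' ∈ (H.comap π).support :=
      Scheme.IdealSheafData.support_antitone (comap_le_controlledTransform π C H 1) hx'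
    rw [Scheme.IdealSheafData.support_comap] at h1
    exact h1
  obtain ⟨U, hxU, u, hHU, δ, hunit, hδ⟩ := hT _ hx
  obtain ⟨V, hVU, b, hb, e, hxV, he⟩ := hπ.exists_chart_of_mem U hxU
  refine ⟨V, hxV, ?_⟩
  -- the chart hypotheses on `Γ(X, U) → Γ(X', V)`
  letI alg : Algebra Γ(X, U) Γ(X', V) := (π.appLE U V hVU).hom.toAlgebra
  obtain ⟨ha, hIb, hext⟩ := chart_hypotheses (k := ℤ) (φ := Int.castRingHom Γ(X, ⊤)) U V hVU hb
    e he rfl (RingHom.ext_int _ _) (RingHom.ext_int _ _)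
  have hsec : ∀ (L : X.IdealSheafData) (m : ℕ), (controlledTransform π C L m).ideal V =
      ((L.ideal U).map (algebraMap Γ(X, U) Γ(X', V))).colon
        {algebraMap Γ(X, U) Γ(X', V) b ^ m} := by
    intro L m
    rw [controlledTransform, ideal_colon, Scheme.IdealSheafData.ideal_pow, Pi.pow_apply,
      ideal_comap_of_le π _ U V hVU, ideal_comap_of_le π _ U V hVU]
    change Submodule.colon ((L.ideal U).map (algebraMap Γ(X, U) Γ(X', V)))
      ↑(((C.ideal U).map (algebraMap Γ(X, U) Γ(X', V))) ^ m) = _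
    rw [hIb, Ideal.span_singleton_pow, Submodule.colon_span]
  have hdiv : ∀ (L : X.IdealSheafData) (m : ℕ), L ≤ C ^ m →
      (L.ideal U).map (algebraMap Γ(X, U) Γ(X', V)) ≤
        Ideal.span {algebraMap Γ(X, U) Γ(X', V) b ^ m} := by
    intro L m hL
    have h1 : L.ideal U ≤ C.ideal U ^ m := by
      have := hL U
      rwa [Scheme.IdealSheafData.ideal_pow, Pi.pow_apply] at this
    calc (L.ideal U).map (algebraMap Γ(X, U) Γ(X', V))
        ≤ (C.ideal U ^ m).map (algebraMap Γ(X, U) Γ(X', V)) := Ideal.map_mono h1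
      _ = Ideal.span {algebraMap Γ(X, U) Γ(X', V) b ^ m} := by
          rw [Ideal.map_pow, hIb, Ideal.span_singleton_pow]
  -- the element `u' = u / b`
  have hub : algebraMap Γ(X, U) Γ(X', V) u ∈ Ideal.span {algebraMap Γ(X, U) Γ(X', V) b} := by
    have h1 := hdiv H 1 (by rw [pow_one]; exact hHC)
    rw [pow_one, hHU, Ideal.map_span, Set.image_singleton, Ideal.span_le,
      Set.singleton_subset_iff] at h1
    exact h1
  obtain ⟨u', hu'⟩ := Ideal.mem_span_singleton'.mp hub
  have hbu' : algebraMap Γ(X, U) Γ(X', V) b * u' = algebraMap Γ(X, U) Γ(X', V) u := by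
    rw [mul_comm]; exact hu'
  refine ⟨u', ?_, ?_⟩
  · -- `H'|_V = (u')`
    rw [hsec H 1, pow_one, hHU, Ideal.map_span, Set.image_singleton]
    exact colon_span_singleton_eq_span_of_mul_eq ha hbu'
  · obtain ⟨D, hD⟩ := hext δ
    refine ⟨D, isUnit_mk_apply_transform ha hD hbu' hunit, ?_⟩
    have key := forall_iterate_transform_mem_iSup_colon ha hD (fun i => (K i).ideal U)
      (fun i hi => hdiv (K i) (μ - i) (hK i hi)) (hdiv I μ hI) hδ
    intro f' hf' j hj
    rw [hsec I μ] at hf'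
    simp_rw [hsec]
    exact key f' hf' j hj

end OneStep

/-! ## Using the invariant at a point: `ord_x 𝓘 ≥ μ` -/

section Use

variable {X : Scheme.{u}}

/-- **From the transverse invariant to `ord_x 𝓘 ≥ μ`** (the inclusion
`supp(𝒞(𝓘, μ)|_S) ⊆ supp(𝓘, μ)` at a later stage of the blow-up sequence; [Wlod] Lemma 3.10.4,
"consequently `supp(𝓘_{k+1}, μ) ∩ S_{k+1} = ⋂ supp(c_{α f k+1}|_{S_{k+1}}, μ - |α|) ⊇ …`"):
at `x ∈ V(u) ∩ U` with `δ(u)` a unit modulo `u`, `δ^j f ∈ (K_0 + ⋯ + K_j)(U)` for `f ∈ 𝓘(U)`,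
`j < μ`, `1, …, μ - 1` units in `𝒪_{X,x}` and `K_{i,x} ⊆ 𝔪_x^{μ-i} + (u_x)` for all `i < μ`:
`𝓘_x ⊆ 𝔪_x^μ`. (Extend `δ` to `𝒪_{X,x}`, rescale it to `δ(u_x) = 1` — iterates of the rescaled
derivation stay in the monotone family — and apply the algebraic core
`Derivation.mem_pow_of_forall_iterate_mem_sup`.) [cite: Wlodarczyk2005, Lemma 3.10.4 (proof)] -/
theorem stalkIdeal_le_pow_of_transverse {I : X.IdealSheafData} {μ : ℕ} {K : ℕ → X.IdealSheafData}
    {x : X} (U : X.affineOpens) (hxU : x ∈ (U : X.Opens)) (u : Γ(X, U))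
    (δ : Derivation ℤ Γ(X, U) Γ(X, U)) (hunit : IsUnit (Ideal.Quotient.mk (Ideal.span {u}) (δ u)))
    (hδ : ∀ f ∈ I.ideal U, ∀ j < μ, δ^[j] f ∈ ⨆ (i : ℕ) (_ : i ≤ j), (K i).ideal U)
    (hux : X.presheaf.germ U x hxU u ∈ maximalIdeal (X.presheaf.stalk x))
    (hunits : ∀ j : ℕ, 0 < j → j < μ → IsUnit (j : X.presheaf.stalk x))
    (hKx : ∀ i < μ, stalkIdeal (K i) x ≤
      maximalIdeal (X.presheaf.stalk x) ^ (μ - i) ⊔ Ideal.span {X.presheaf.germ U x hxU u}) :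
    stalkIdeal I x ≤ maximalIdeal (X.presheaf.stalk x) ^ μ := by
  -- the stalk as a localization of `Γ(X, U)`
  letI algx : Algebra Γ(X, U) (X.presheaf.stalk x) := (X.presheaf.germ U x hxU).hom.toAlgebra
  haveI : IsLocalization.AtPrime (X.presheaf.stalk x) (U.2.primeIdealOf ⟨x, hxU⟩).asIdeal :=
    U.2.isLocalization_stalk ⟨x, hxU⟩
  have halg : ∀ r : Γ(X, U), algebraMap Γ(X, U) (X.presheaf.stalk x) r =
      X.presheaf.germ U x hxU r := fun r => rfl
  obtain ⟨δ', hδ'⟩ := exists_derivation_extend_of_isLocalization ℤ (X.presheaf.stalk x)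
    (U.2.primeIdealOf ⟨x, hxU⟩).asIdeal.primeCompl δ
  -- `δ'(u_x)` is a unit
  have hu' : IsUnit (δ' (X.presheaf.germ U x hxU u)) := by
    obtain ⟨vbar, hvbar⟩ := hunit.exists_right_inv
    obtain ⟨v, rfl⟩ := Ideal.Quotient.mk_surjective vbar
    rw [← map_mul, ← map_one (Ideal.Quotient.mk (Ideal.span {u})), Ideal.Quotient.eq,
      Ideal.mem_span_singleton'] at hvbar
    obtain ⟨w, hw⟩ := hvbar
    -- `δ' u_x · v_x = 1 + w_x u_x`, a unit of the local ring
    have h1 : δ' (X.presheaf.germ U x hxU u) * algebraMap Γ(X, U) _ v -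
        1 ∈ maximalIdeal (X.presheaf.stalk x) := by
      rw [← halg, hδ', ← map_mul, ← map_one (algebraMap Γ(X, U) (X.presheaf.stalk x)),
        ← map_sub, ← hw, map_mul, halg, halg]
      exact Ideal.mul_mem_left _ _ hux
    have h2 : IsUnit (δ' (X.presheaf.germ U x hxU u) * algebraMap Γ(X, U) _ v) := by
      by_contra h
      rw [← mem_nonunits_iff, ← mem_maximalIdeal] at h
      have := sub_mem h h1
      rw [sub_sub_cancel] at this
      exact (maximalIdeal.isMaximal (X.presheaf.stalk x)).ne_top
        ((Ideal.eq_top_iff_one _).mpr this)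
    exact isUnit_of_mul_isUnit_left h2
  -- the family of stalks `F_j = K_{0,x} + ⋯ + K_{j,x}`
  obtain ⟨F, hF⟩ : ∃ F : ℕ → Ideal (X.presheaf.stalk x),
      F = fun j => ⨆ (i : ℕ) (_ : i ≤ j), stalkIdeal (K i) x := ⟨_, rfl⟩
  have hFmono : Monotone F := fun j j' hjj' => by
    rw [hF]
    exact biSup_mono fun i hi => hi.trans hjj'
  -- all iterates of all elements of `𝓘_x` lie in the family
  have hgen : ∀ g ∈ (fun f => algebraMap Γ(X, U) (X.presheaf.stalk x) f) '' (I.ideal U : Set Γ(X, U)),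
      ∀ j < μ, δ'^[j] g ∈ F j := by
    rintro _ ⟨f, hf, rfl⟩ j hj
    rw [Derivation.iterate_apply_algebraMap δ δ' hδ', hF]
    have hle : (⨆ (i : ℕ) (_ : i ≤ j), (K i).ideal U).map (algebraMap Γ(X, U) (X.presheaf.stalk x)) ≤
        ⨆ (i : ℕ) (_ : i ≤ j), stalkIdeal (K i) x := by
      rw [Ideal.map_iSup]
      refine iSup_mono fun i => ?_
      rw [Ideal.map_iSup]
      refine iSup_mono fun _ => ?_
      rw [stalkIdeal_eq_map_germ (K i) U hxU]
      exact le_of_eq rfl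
    exact hle (Ideal.mem_map_of_mem _ (hδ f hf j hj))
  have hall : ∀ h ∈ stalkIdeal I x, ∀ j < μ, δ'^[j] h ∈ F j := by
    rw [stalkIdeal_eq_map_germ I U hxU]
    exact Derivation.forall_iterate_mem_of_mem_span δ' hFmono hgen
  -- rescale and conclude
  obtain ⟨w, hw⟩ := hu'
  have h1 : ((↑w⁻¹ : X.presheaf.stalk x) • δ') (X.presheaf.germ U x hxU u) = 1 := by
    rw [Derivation.smul_apply, smul_eq_mul, ← hw, Units.inv_mul]
  intro f hf
  refine Derivation.mem_pow_of_forall_iterate_mem_sup ℤ _ hux h1 μ hunits fun i hi => ?_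
  have h2 : ((↑w⁻¹ : X.presheaf.stalk x) • δ')^[i] f ∈ F i :=
    Derivation.iterate_smul_mem δ' hFmono _ f fun l hl => hall f hf l (by omega)
  rw [hF] at h2
  have hle : (⨆ (l : ℕ) (_ : l ≤ i), stalkIdeal (K l) x) ≤
      maximalIdeal (X.presheaf.stalk x) ^ (μ - i) ⊔ Ideal.span {X.presheaf.germ U x hxU u} :=
    iSup₂_le fun l hl =>
      (hKx l (by omega)).trans (sup_le_sup_right (Ideal.pow_le_pow_right (by omega)) _)
  exact hle h2

end Use

/-! ## The support identity from the invariant -/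

section Support

variable {k : Type v} [CommRing k] {X : Scheme.{u}} {φ : k →+* Γ(X, ⊤)}

/-- **BGMW Lemma 3.9.4 (2) at one stage, from the invariants**: let `(X, 𝓘, E, μ)` be a marked
ideal on a scheme with `k`-structure (finitely presented differentials), `S = V(H)` a hypersurface
whose ambient local rings are regular and whose stalks `H_x` have order-one generators, and let
`K_0, K_1, …` be ideal sheaves with `K_i ⊆ 𝒟ⁱ(𝓘)` carrying the transverse invariant (affine
neighbourhoods `U`, `H|_U = (u)`, derivations `δ` with `δ(u)` a unit mod `u` and
`δ^j f ∈ (K_0 + ⋯ + K_j)(U)` for `f ∈ 𝓘(U)`, `j < μ`), `1, …, μ - 1` units. Then the marked ideal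
`𝒩 = (Σ_{i<μ} (K_i|_S)^{Π_{j≠i}(μ-j)}, Π_j (μ-j))` on `S` (at the start `𝒩 = 𝒞(𝓘, μ)|_S`; after
blow-ups, its transforms) satisfies **`supp 𝒩 = ι⁻¹ supp(𝓘, μ)`**, i.e.
`supp(𝓘_i, μ) ∩ S_i = supp[𝒞(𝓘, μ)|_S]_i`. [cite: BierstoneGrigorievMilmanWlodarczyk2011, Lemma 3.9.4 (2)] -/
theorem MarkedIdeal.support_eq_preimage_of_transverse (hX : HasFinitePresentationDifferentials φ)
    {H : X.IdealSheafData} (M : MarkedIdeal X) {K : ℕ → X.IdealSheafData}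
    (hK1 : ∀ i < M.mult, K i ≤ derivIdealSheafIter φ i M.ideal)
    (hT : ∀ x ∈ H.support, ∃ U : X.affineOpens, x ∈ (U : X.Opens) ∧ ∃ u : Γ(X, U),
      H.ideal U = Ideal.span {u} ∧ ∃ δ : Derivation ℤ Γ(X, U) Γ(X, U),
        IsUnit (Ideal.Quotient.mk (Ideal.span {u}) (δ u)) ∧
        ∀ f ∈ M.ideal.ideal U, ∀ j < M.mult, δ^[j] f ∈ ⨆ (i : ℕ) (_ : i ≤ j), (K i).ideal U)
    (hunit : ∀ (x : X) (j : ℕ), 0 < j → j < M.mult → IsUnit (j : X.presheaf.stalk x))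
    (hreg : ∀ x ∈ H.support, IsRegularLocalRing (X.presheaf.stalk x))
    (hH : ∀ x ∈ H.support, ∃ v : X.presheaf.stalk x,
      stalkIdeal H x = Ideal.span {v} ∧ v ∉ maximalIdeal (X.presheaf.stalk x) ^ 2)
    (N : MarkedIdeal H.subscheme)
    (hNI : N.ideal = ⨆ i : Fin M.mult,
      ((K i).comap H.subschemeι) ^ (∏ j ∈ Finset.univ.erase i, (M.mult - (j : ℕ))))
    (hNm : N.mult = ∏ j : Fin M.mult, (M.mult - (j : ℕ))) :
    N.support = H.subschemeι ⁻¹' M.support := by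
  ext s
  have hxH := subschemeι_apply_mem_support H s
  obtain ⟨v, hHv, hv2⟩ := hH _ hxH
  haveI := hreg _ hxH
  -- both sides in terms of the stalks `K_{i,x}`
  have key : s ∈ N.support ↔ ∀ i < M.mult, stalkIdeal (K i) (H.subschemeι s) ≤
      maximalIdeal (X.presheaf.stalk (H.subschemeι s)) ^ (M.mult - i) ⊔ Ideal.span {v} := by
    rw [MarkedIdeal.mem_support_iff, hNI, hNm, stalkIdeal_iSup, iSup_le_iff, Fin.forall_iff]
    refine forall₂_congr fun i hi => ?_
    have he : 0 < ∏ j ∈ Finset.univ.erase (⟨i, hi⟩ : Fin M.mult), (M.mult - (j : ℕ)) :=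
      Finset.prod_pos fun j _ => by
        have := j.2
        omega
    rw [stalkIdeal_pow, stalkIdeal_comap_eq_map_stalkMap, ← Ideal.map_pow,
      ← M.sub_mul_prod_erase ⟨i, hi⟩, mul_comm, map_stalkMap_subschemeι_pow_le_iff s hHv hv2 _ he]
  rw [key, Set.mem_preimage, MarkedIdeal.mem_support_iff]
  constructor
  · -- `⊆`: the transverse invariant at `x`
    intro hKv
    obtain ⟨U, hxU, u, hHU, δ, hunit', hδ⟩ := hT _ hxH
    -- the generator `u_x` of `H_x = (v)`
    have hHu : stalkIdeal H (H.subschemeι s) = Ideal.span {X.presheaf.germ U _ hxU u} := by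
      rw [stalkIdeal_eq_map_germ H U hxU, hHU, Ideal.map_span, Set.image_singleton]
    have hux : X.presheaf.germ U _ hxU u ∈ maximalIdeal (X.presheaf.stalk (H.subschemeι s)) := by
      have h1 : H.subschemeι s ∈ H.support := hxH
      rw [mem_support_iff_stalkIdeal_le, hHu, Ideal.span_singleton_le_iff_mem] at h1
      exact h1
    refine stalkIdeal_le_pow_of_transverse U hxU u δ hunit' hδ hux (hunit _) fun i hi => ?_
    rw [← hHu, hHv]
    exact hKv i hi
  · -- `⊇`: `K_i ⊆ 𝒟ⁱ(𝓘)`, every characteristic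
    intro hI i hi
    letI := stalkAlgebra φ (H.subschemeι s)
    calc stalkIdeal (K i) (H.subschemeι s)
        ≤ stalkIdeal (derivIdealSheafIter φ i M.ideal) (H.subschemeι s) := stalkIdeal_mono (hK1 i hi) _
      _ = derivIdealIter k i (stalkIdeal M.ideal (H.subschemeι s)) := stalkIdeal_derivIdealSheafIter hX i _ _
      _ ≤ maximalIdeal _ ^ (M.mult - i) := derivIdealIter_le_pow_sub k hI i
      _ ≤ _ := le_sup_left

end Support

/-! ## The invariant at the start: a locally principal hypersurface with order-one generators -/

section Start

variable {k : Type v} [CommRing k] {X : Scheme.{u}} {φ : k →+* Γ(X, ⊤)}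

/-- **An order-one section generator has a transverse derivation near the point**: on a scheme
with finitely presented differentials and local coordinates, if `u ∈ Γ(X, U)` has germ of order
one at `x ∈ V(u)`, then `δ(u)(x) ≠ 0` for some `k`-derivation `δ` of `Γ(X, U)` (the locus
`ord ≥ 2` of `u` is `V(𝒟(u))`, `germ_mem_sq_iff_mem_zeroLocus_derivIdeal`).
[cite: BierstoneGrigorievMilmanWlodarczyk2011, Lemma 3.6.4 (1)] -/
theorem exists_derivation_isUnit_germ (hX : HasFinitePresentationDifferentials φ)
    (hc : HasLocalCoordinates φ) (U : X.affineOpens) (u : Γ(X, U)) {x : X}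
    (hxU : x ∈ (U : X.Opens)) (hux : X.presheaf.germ U x hxU u ∈ maximalIdeal (X.presheaf.stalk x))
    (hu2 : X.presheaf.germ U x hxU u ∉ maximalIdeal (X.presheaf.stalk x) ^ 2) :
    ∃ δ : (letI := sectionsAlgebra φ U; Derivation k Γ(X, U) Γ(X, U)),
      IsUnit (X.presheaf.germ U x hxU (δ u)) := by
  letI := sectionsAlgebra φ U
  by_contra h
  push Not at h
  apply hu2
  rw [germ_mem_sq_iff_mem_zeroLocus_derivIdeal hX hc U u hxU, Scheme.mem_zeroLocus_iff]
  intro g hg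
  rw [X.mem_basicOpen g x hxU]
  -- `𝒟(u) ⊆ germ⁻¹(𝔪_x)`
  have hle : derivIdeal k (Ideal.span {u}) ≤
      (maximalIdeal (X.presheaf.stalk x)).comap (X.presheaf.germ U x hxU).hom := by
    rw [derivIdeal_le_iff]
    constructor
    · rw [Ideal.span_le, Set.singleton_subset_iff]
      exact hux
    · intro δ f hf
      obtain ⟨c, rfl⟩ := Ideal.mem_span_singleton'.mp hf
      rw [Ideal.mem_comap, Derivation.leibniz, smul_eq_mul, smul_eq_mul, map_add, map_mul, map_mul]
      refine add_mem (Ideal.mul_mem_left _ _ ?_) (Ideal.mul_mem_right _ _ hux)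
      rw [mem_maximalIdeal, mem_nonunits_iff]
      exact h δ
  have := hle hg
  rw [Ideal.mem_comap, mem_maximalIdeal, mem_nonunits_iff] at this
  exact this

/-- **The transverse invariant holds at the start** ([Wlod] Lemma 3.10.4, base of the induction,
derivation form), with `K_i = 𝒟ⁱ(𝓘)`: on a scheme with finitely presented differentials and
local coordinates with dual derivations, for an ideal sheaf `H` which around each point of `V(H)`
is generated by a section of order one at that point (a regular hypersurface `S = V(H)` given by
local equations — a maximal contact hypersurface `V(u)`, or an exceptional hypersurface), every
point of `V(H)` has an affine neighbourhood `U` with `H|_U = (u)` and a derivation `δ` with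
`δ(u)` a unit modulo `u` and (trivially) `δ^j f ∈ 𝒟^j(𝓘)(U) ⊆ (𝒟⁰𝓘 + ⋯ + 𝒟^j𝓘)(U)`: shrink to
the basic open where `δ(u)` is invertible. [cite: Wlodarczyk2005, Lemma 3.10.4 (proof)] -/
theorem transverse_derivIdealSheafIter (hX : HasFinitePresentationDifferentials φ)
    (hc : HasLocalCoordinates φ) {H : X.IdealSheafData}
    (hHloc : ∀ x ∈ H.support, ∃ (U : X.affineOpens) (hxU : x ∈ (U : X.Opens)) (u : Γ(X, U)),
      H.ideal U = Ideal.span {u} ∧ X.presheaf.germ U x hxU u ∉ maximalIdeal (X.presheaf.stalk x) ^ 2)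
    (I : X.IdealSheafData) (μ : ℕ) :
    ∀ x ∈ H.support, ∃ U : X.affineOpens, x ∈ (U : X.Opens) ∧ ∃ u : Γ(X, U),
      H.ideal U = Ideal.span {u} ∧ ∃ δ : Derivation ℤ Γ(X, U) Γ(X, U),
        IsUnit (Ideal.Quotient.mk (Ideal.span {u}) (δ u)) ∧
        ∀ f ∈ I.ideal U, ∀ j < μ,
          δ^[j] f ∈ ⨆ (i : ℕ) (_ : i ≤ j), (derivIdealSheafIter φ i I).ideal U := by
  intro x hx
  obtain ⟨U, hxU, u, hHU, hu2⟩ := hHloc x hx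
  letI := sectionsAlgebra φ U
  have hux : X.presheaf.germ U x hxU u ∈ maximalIdeal (X.presheaf.stalk x) := by
    have h1 := hx
    rw [mem_support_iff_stalkIdeal_le, stalkIdeal_eq_map_germ H U hxU, hHU, Ideal.map_span,
      Set.image_singleton, Ideal.span_singleton_le_iff_mem] at h1
    exact h1
  obtain ⟨δ₀, hδ₀⟩ := exists_derivation_isUnit_germ hX hc U u hxU hux hu2
  -- shrink to the basic open `U' = D(δ₀ u) ∩ U`
  have hxU' : x ∈ X.basicOpen (δ₀ u) := (X.mem_basicOpen (δ₀ u) x hxU).mpr hδ₀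
  -- the affine open `U' = D(δ₀ u) ∩ U`
  obtain ⟨U', hU'⟩ : ∃ U' : X.affineOpens, U' = ⟨X.basicOpen (δ₀ u), U.2.basicOpen (δ₀ u)⟩ :=
    ⟨_, rfl⟩
  have hU'U : U' ≤ U := by rw [hU']; exact X.basicOpen_le (δ₀ u)
  have hU'eq : (U' : X.Opens) = X.basicOpen (δ₀ u) := by rw [hU']
  refine ⟨U', hU'eq ▸ hxU', X.presheaf.map (homOfLE hU'U).op u, ?_, ?_⟩
  · rw [← H.map_ideal hU'U, hHU, Ideal.map_span, Set.image_singleton]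
  · -- extend `δ₀` to the localization `Γ(X, U') = Γ(X, U)[1/δ₀ u]`
    subst hU'
    letI := sectionsAlgebra φ (X.basicOpen (δ₀ u))
    haveI : IsScalarTower k Γ(X, U) Γ(X, X.basicOpen (δ₀ u)) :=
      IsScalarTower.of_algebraMap_eq fun c =>
        (RingHom.congr_fun (map_comp_sectionsHom φ (X.basicOpen_le (δ₀ u))) c).symm
    haveI := U.2.isLocalization_basicOpen (δ₀ u)
    obtain ⟨δ₁, hδ₁⟩ := exists_derivation_extend_of_isLocalization k (Γ(X, X.basicOpen (δ₀ u)))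
      (Submonoid.powers (δ₀ u)) δ₀
    refine ⟨δ₁.restrictScalars ℤ, ?_, ?_⟩
    · -- `δ₁ (u|U') = (δ₀ u)|U'`, a unit
      have h1 : IsUnit ((δ₁.restrictScalars ℤ) (X.presheaf.map (homOfLE hU'U).op u)) := by
        have h2 : (δ₁.restrictScalars ℤ) (X.presheaf.map (homOfLE hU'U).op u) =
            algebraMap Γ(X, U) Γ(X, X.basicOpen (δ₀ u)) (δ₀ u) := hδ₁ u
        rw [h2]
        exact IsLocalization.Away.algebraMap_isUnit (δ₀ u)
      exact h1.map _
    · intro f hf j hj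
      have hle : (derivIdealSheafIter φ j I).ideal ⟨X.basicOpen (δ₀ u), U.2.basicOpen (δ₀ u)⟩ ≤
          ⨆ (i : ℕ) (_ : i ≤ j),
            (derivIdealSheafIter φ i I).ideal ⟨X.basicOpen (δ₀ u), U.2.basicOpen (δ₀ u)⟩ :=
        le_biSup (fun i => (derivIdealSheafIter φ i I).ideal
          ⟨X.basicOpen (δ₀ u), U.2.basicOpen (δ₀ u)⟩) (le_refl j)
      refine hle ?_
      rw [derivIdealSheafIter_ideal hX]
      exact Derivation.iterate_apply_mem_derivIdealIter k δ₁ hf j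

end Start

/-! ## The restricted coefficient ideal and its transforms -/

section Coefficient

variable {k : Type v} [CommRing k] {X X' : Scheme.{u}} (φ : k →+* Γ(X, ⊤)) {π : X' ⟶ X}
  {C H : X.IdealSheafData}

/-- **The ideal of `𝒞(𝓘, μ)|_Y = ι^*𝒞(𝓘, μ)`** for any morphism `f : Y → X`:
`Σ_{i<μ} (f^*𝒟ⁱ𝓘)^{Π_{j≠i}(μ-j)}`. [cite: BierstoneGrigorievMilmanWlodarczyk2011, Def. 3.9.2 with Lemma 3.9.4] -/
theorem MarkedIdeal.coeff_comap_ideal (M : MarkedIdeal X) {Y : Scheme.{u}} (f : Y ⟶ X) :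
    ((M.coeff φ).comap f).ideal = ⨆ i : Fin M.mult,
      ((derivIdealSheafIter φ i M.ideal).comap f) ^ (∏ j ∈ Finset.univ.erase i, (M.mult - (j : ℕ))) := by
  rw [MarkedIdeal.comap_ideal, MarkedIdeal.coeff_ideal, Scheme.IdealSheafData.comap_iSup]
  simp_rw [comap_pow]

variable {φ}

variable [IsLocallyNoetherian X]

/-- **The transform of a restricted sum of powers along the restricted blow-up** ([Wlod]
Lemma 3.10.3 with BGMW Lemma 3.7.1, for the shape of `𝒞(𝓘, μ)|_S`): with `X`, `π`, `C`, `H`,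
`πS : S' → S` as in `IsBlowup.comap_subschemeι_controlledTransform` and ideal sheaves
`K_i ⊆ C^{μ-i}` (`i < μ`), if a marked ideal `𝒩` on `S = V(H)` has ideal
`Σ_{i<μ} (K_i|_S)^{Π_{j≠i}(μ-j)}` and multiplicity `Π_j (μ - j)`, then its transform along `πS`
with centre `C|_S` has ideal `Σ_{i<μ} (K_i'|_{S'})^{Π_{j≠i}(μ-j)}`, `K_i' = σᶜ(K_i, μ - i)`.
[cite: BierstoneGrigorievMilmanWlodarczyk2011, Lemma 3.9.4 (1)–(2)] -/
theorem IsBlowup.transform_ideal_of_eq_iSup_comap_subschemeι (hX : Scheme.IsRegular X)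
    (hπ : IsBlowup π C) (hC : Scheme.IsRegular C.subscheme) (hHC : H ≤ C)
    (hH : ∀ x ∈ H.support, ∃ v : X.presheaf.stalk x,
      stalkIdeal H x = Ideal.span {v} ∧ v ∉ (maximalIdeal (X.presheaf.stalk x)) ^ 2)
    (πS : (controlledTransform π C H 1).subscheme ⟶ H.subscheme)
    (hπS : πS ≫ H.subschemeι = (controlledTransform π C H 1).subschemeι ≫ π)
    {μ : ℕ} {K : ℕ → X.IdealSheafData} (hK : ∀ i < μ, K i ≤ C ^ (μ - i))
    (N : MarkedIdeal H.subscheme)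
    (hNI : N.ideal = ⨆ i : Fin μ,
      ((K i).comap H.subschemeι) ^ (∏ j ∈ Finset.univ.erase i, (μ - (j : ℕ))))
    (hNm : N.mult = ∏ j : Fin μ, (μ - (j : ℕ))) :
    (N.transform πS (C.comap H.subschemeι)).ideal = ⨆ i : Fin μ,
      ((controlledTransform π C (K i) (μ - i)).comap (controlledTransform π C H 1).subschemeι) ^
        (∏ j ∈ Finset.univ.erase i, (μ - (j : ℕ))) := by
  haveI : IsProper π := hπ.isProper
  haveI : IsLocallyNoetherian X' := LocallyOfFiniteType.isLocallyNoetherian π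
  haveI : IsLocallyNoetherian (controlledTransform π C H 1).subscheme :=
    LocallyOfFiniteType.isLocallyNoetherian (controlledTransform π C H 1).subschemeι
  have hDS : (C.comap H.subschemeι).comap πS =
      (C.comap π).comap (controlledTransform π C H 1).subschemeι := by
    rw [← Scheme.IdealSheafData.comap_comp, hπS, Scheme.IdealSheafData.comap_comp]
  have hD' : IsEffectiveCartier ((C.comap H.subschemeι).comap πS) :=
    hDS ▸ hπ.isEffectiveCartier_comap_subschemeι_controlledTransform hX hC hHC hH
  have hL : ∀ i : Fin μ, ((K i).comap H.subschemeι).comap πS ≤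
      (C.comap H.subschemeι).comap πS ^ (μ - (i : ℕ)) := by
    intro i
    rw [← Scheme.IdealSheafData.comap_comp, hπS, hDS, ← comap_pow, ← comap_pow,
      ← Scheme.IdealSheafData.comap_comp]
    exact Scheme.IdealSheafData.comap_mono
      (f := (controlledTransform π C H 1).subschemeι ≫ π) (hK i i.2)
  have huniv : ∀ F : Fin μ → (controlledTransform π C H 1).subscheme.IdealSheafData,
      (⨆ i, F i) = ⨆ i ∈ (Finset.univ : Finset (Fin μ)), F i := fun F => by simp
  have huniv' : ∀ F : Fin μ → H.subscheme.IdealSheafData,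
      (⨆ i, F i) = ⨆ i ∈ (Finset.univ : Finset (Fin μ)), F i := fun F => by simp
  rw [MarkedIdeal.transform_ideal, hNI, hNm, huniv', huniv,
    controlledTransform_finset_biSup_pow hD' Finset.univ
      (fun i : Fin μ => (K i).comap H.subschemeι)
      (fun i : Fin μ => μ - (i : ℕ)) (fun i : Fin μ => ∏ j ∈ Finset.univ.erase i, (μ - (j : ℕ)))
      (fun i _ => by
        rw [mul_comm]
        exact Finset.mul_prod_erase Finset.univ (fun j : Fin μ => μ - (j : ℕ)) (Finset.mem_univ i))
      (fun i _ => hL i)]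
  refine iSup_congr fun i => iSup_congr fun _ => ?_
  rw [hπ.comap_subschemeι_controlledTransform hX hC hHC hH πS hπS
    (comap_le_comap_pow_of_le_pow (hK i i.2) π)]

omit [IsLocallyNoetherian X] in
/-- Order-one local generators given by sections yield order-one generators of the stalks.
[folklore] -/
theorem exists_stalk_generator_of_sections
    (hHloc : ∀ x ∈ H.support, ∃ (U : X.affineOpens) (hxU : x ∈ (U : X.Opens)) (u : Γ(X, U)),
      H.ideal U = Ideal.span {u} ∧ X.presheaf.germ U x hxU u ∉ maximalIdeal (X.presheaf.stalk x) ^ 2) :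
    ∀ x ∈ H.support, ∃ v : X.presheaf.stalk x,
      stalkIdeal H x = Ideal.span {v} ∧ v ∉ (maximalIdeal (X.presheaf.stalk x)) ^ 2 := by
  intro x hx
  obtain ⟨U, hxU, u, hHU, hu2⟩ := hHloc x hx
  refine ⟨X.presheaf.germ U x hxU u, ?_, hu2⟩
  rw [stalkIdeal_eq_map_germ H U hxU, hHU, Ideal.map_span, Set.image_singleton]

/-- **BGMW Lemma 3.9.4 (2) for one blow-up: `supp(𝓘', μ) ∩ S' = supp((𝒞(𝓘, μ)|_S)')`.** Let `X`
be a locally Noetherian regular scheme with `k`-structure `φ` having finitely presented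
differentials and local coordinates with dual derivations (also finitely presented differentials
on `X'`; e.g. `X` smooth over a perfect field), `(X, 𝓘, E, μ)` a marked ideal with `1, …, μ - 1`
units in the local rings of `X'`, `S = V(H)` a hypersurface given around each of its points by a
section of order one (a maximal contact hypersurface, Lemma 3.6.4, or an exceptional one), and
`π : X' → X` a blow-up with centre `C` admissible for `(𝓘, E, μ)` (`V(C) ⊆ supp(𝓘, μ)` regular,
snc with `E`) and contained in `S` (`H ⊆ C`). Then for the strict transform `S' = V(H')`,
`H' = σᶜ(H, 1)`, the induced blow-up `πS : S' → S` (restriction property, §4 Remark (3)) and the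
restricted coefficient ideal `𝒞(𝓘, μ)|_S = ι^*𝒞(𝓘, μ)` (Def. 3.9.2, Lemma 3.9.4):
`supp((𝒞(𝓘, μ)|_S)') = ι'⁻¹ supp((𝓘, μ)')`, the transforms taken along `πS` with centre `C|_S`,
resp. along `π` with centre `C`. This is clause (2) of Lemma 3.9.4 after the first blow-up; the
hypotheses re-establish themselves on `X'` (`IsBlowup.transverse_transform`,
`IsBlowup.transform_ideal_of_eq_iSup_comap_subschemeι`, `IsBlowup.controlledTransform_derivIdealSheafIter_le`,
`IsBlowup.exists_generator_notMem_sq_controlledTransform`), so that the identity persists along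
multiple blow-ups with centres in the successive strict transforms of `S`
(`MarkedIdeal.support_eq_preimage_of_transverse` at each stage).
[cite: BierstoneGrigorievMilmanWlodarczyk2011, Lemma 3.9.4 (2)] -/
theorem IsBlowup.support_transform_coeff_comap_subschemeι
    (hX : HasFinitePresentationDifferentials φ)
    (hX' : HasFinitePresentationDifferentials (π.appTop.hom.comp φ)) (hc : HasLocalCoordinates φ)
    (hXreg : Scheme.IsRegular X) (hπ : IsBlowup π C) (hC : Scheme.IsRegular C.subscheme)
    (hHC : H ≤ C)
    (hHloc : ∀ x ∈ H.support, ∃ (U : X.affineOpens) (hxU : x ∈ (U : X.Opens)) (u : Γ(X, U)),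
      H.ideal U = Ideal.span {u} ∧ X.presheaf.germ U x hxU u ∉ maximalIdeal (X.presheaf.stalk x) ^ 2)
    (M : MarkedIdeal X) (hsupp : (C.support : Set X) ⊆ M.support) (hsnc : HasSNCWith M.boundary C)
    (hunit : ∀ (x' : X') (j : ℕ), 0 < j → j < M.mult → IsUnit (j : X'.presheaf.stalk x'))
    (πS : (controlledTransform π C H 1).subscheme ⟶ H.subscheme)
    (hπS : πS ≫ H.subschemeι = (controlledTransform π C H 1).subschemeι ≫ π) :
    (((M.coeff φ).comap H.subschemeι).transform πS (C.comap H.subschemeι)).support =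
      (controlledTransform π C H 1).subschemeι ⁻¹' (M.transform π C).support := by
  haveI : IsProper π := hπ.isProper
  haveI : IsLocallyNoetherian X' := LocallyOfFiniteType.isLocallyNoetherian π
  have hH := exists_stalk_generator_of_sections hHloc
  have hI : M.ideal ≤ C ^ M.mult := M.ideal_le_pow hsupp hsnc
  have hK : ∀ i < M.mult, derivIdealSheafIter φ i M.ideal ≤ C ^ (M.mult - i) := fun i _ =>
    (M.deriv φ i).ideal_le_pow (hsupp.trans (M.support_subset_support_deriv hX i)) hsnc
  -- the invariants on `X'`
  have hT' := hπ.transverse_transform hHC hI hK (transverse_derivIdealSheafIter hX hc hHloc M.ideal M.mult)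
  have hK1' : ∀ i < M.mult, controlledTransform π C (derivIdealSheafIter φ i M.ideal) (M.mult - i) ≤
      derivIdealSheafIter (π.appTop.hom.comp φ) i (M.transform π C).ideal := fun i hi =>
    hπ.controlledTransform_derivIdealSheafIter_le hX hX' hI hi.le
  refine MarkedIdeal.support_eq_preimage_of_transverse hX' (M.transform π C) hK1' hT' hunit
    (fun x' _ => hπ.isRegular_of_isRegular_subscheme hXreg hC x')
    (hπ.exists_generator_notMem_sq_controlledTransform hXreg hC hHC hH) _ ?_ rfl
  exact hπ.transform_ideal_of_eq_iSup_comap_subschemeι hXreg hC hHC hH πS hπS hK _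
    (M.coeff_comap_ideal φ H.subschemeι)
    (((M.coeff φ).comap_mult H.subschemeι).trans (M.coeff_mult_eq_prod φ))

end Coefficient

end Literature.AlgebraicGeometry.Resolution

end
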